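import Mathlib
import Summits.ValiantsHypothesis.ValiantsHypothesis.Theorems.NewtonUnitEquationsTwoProductsEchelonPivots
import Summits.ValiantsHypothesis.ValiantsHypothesis.Theorems.NewtonUnitEquationsTwoProductsBinomialY

/-! # Stub `stub_engineSeparated` — crux `TwoProducts` (stmt-ValiantsHypothesis-5906), line `corner-log-linearization`

SEPARATED FACTORS.  If every factor is `u_i = A_i(x) + B_i(x)·g_i(y)` (`A_i, B_i` supported on the `x`-axis,
`g_i` on the `y`-axis) and likewise `v_i = A'_i + B'_i·g'_i`, then `D = ∏ u_i − ∏ v_i` has at most `2^(n+1)`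
south-west vertices (strict minimisers of the support for integer weights with both entries `> 0`), whatever
the number of monomials and the degrees.

Mechanism (rows of `D` live in a space of dimension `≤ 2^(n+1)`):
* `∏ (A_i + B_i g_i) = Σ_t R_t(x)·Γ_t(y)` over subsets `t`, with `R_t = ∏_{i∈t} A_i · ∏_{i∉t} B_i` on the
  `x`-axis and `Γ_t = ∏_{i∉t} g_i` on the `y`-axis (`Finset.prod_add`); coefficients of such products factor,
  so row `m` of `D` (the coefficients of `x^k y^m`, `k ≥ 0`) is the `x`-axis polynomial
  `Row m = Σ_t [y^m]Γ_t · R_t − Σ_t [y^m]Γ'_t · R'_t`, a member of the span `W` of the `2^(n+1)` polynomials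
  `R_t, R'_t`.
* ECHELON (`EchelonPivots.exists_echelon`, weight = abscissa, injective on the `x`-axis): `W` is spanned by
  `r ≤ 2^(n+1)` polynomials with pairwise distinct strict minimal abscissae (pivots); hence the least abscissa
  of any nonzero member of `W` is a pivot abscissa (`exists_min_pivot`).
* A vertex `e` is the leftmost point of its row (same ordinate, smaller abscissa is `w`-smaller), so `e 0`
  is the least abscissa of `Row (e 1) ≠ 0`, a pivot abscissa; and `e ↦ e 0` is injective on vertices (two
  vertices above each other: the lower one beats the upper one for the upper one's weight).  Count: `≤ r`.
Uniform in `t` and all degrees; `n = 0` gives `D = 0` and no vertex. [folklore] -/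

set_option linter.dupNamespace false -- single-conjunct summit: `ValiantsHypothesis.ValiantsHypothesis`

namespace Summit.ValiantsHypothesis.ValiantsHypothesis.Theorems.TwoProducts.Separated

open scoped BigOperators
open MvPolynomial
-- `Finset.antidiagonal` alone resolves to the `Set.IsPWO` antidiagonal of `Data.Finset.MulAntidiagonal`
open Finset.HasAntidiagonal (antidiagonal mem_antidiagonal)
open Summit.ValiantsHypothesis.ValiantsHypothesis.Theorems.TwoProducts.EchelonPivots (exists_echelon)
open Summit.ValiantsHypothesis.ValiantsHypothesis.Theorems.TwoProducts.BinomialY (leader_apply)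

variable {K : Type*} [Field K]

/-! ## Axis-supported polynomials -/

section Axes

variable {σ : Type*}

/-- A product of two polynomials not involving the variable `j` does not involve `j`. [folklore] -/
theorem mul_support_apply_eq_zero (j : σ) (a b : MvPolynomial σ K) (ha : ∀ q ∈ a.support, q j = 0)
    (hb : ∀ q ∈ b.support, q j = 0) : ∀ q ∈ (a * b).support, q j = 0 := by
  classical
  intro q hq
  obtain ⟨x, hx, y, hy, rfl⟩ := Finset.mem_add.mp (MvPolynomial.support_mul a b hq)
  rw [Finsupp.add_apply, ha x hx, hb y hy, add_zero]

/-- A finite product of polynomials not involving the variable `j` does not involve `j`. [folklore] -/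
theorem prod_support_apply_eq_zero {ι : Type*} (j : σ) (s : Finset ι) (f : ι → MvPolynomial σ K)
    (hf : ∀ i ∈ s, ∀ q ∈ (f i).support, q j = 0) : ∀ q ∈ (∏ i ∈ s, f i).support, q j = 0 := by
  classical
  refine Finset.prod_induction f (fun a => ∀ q ∈ a.support, q j = 0)
    (fun a b ha hb => mul_support_apply_eq_zero j a b ha hb) ?_ hf
  intro q hq
  rw [MvPolynomial.support_one, Finset.mem_singleton] at hq
  simp [hq]

/-! ## Echelon families: the least weight of a nonzero combination is a pivot weight -/

/-- KEY ECHELON FACT.  Let `F ρ` have strict `ω`-minimal support points `p ρ` (pivots), pairwise distinct.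
For a nonzero combination `Σ d ρ • F ρ`, the pivot `p ρ*` of least weight among the `ρ` with `d ρ ≠ 0` lies
in the support of the combination (no other `F ρ` with `d ρ ≠ 0` sees it) and has the least weight of that
support. [folklore] -/
theorem exists_min_pivot {r : ℕ} (F : Fin r → MvPolynomial σ K) (p : Fin r → (σ →₀ ℕ)) (ω : (σ →₀ ℕ) → ℤ)
    (hp : ∀ ρ, p ρ ∈ (F ρ).support ∧ ∀ q ∈ (F ρ).support, q ≠ p ρ → ω (p ρ) < ω q)
    (hinj : Function.Injective p) (d : Fin r → K) (hf : ∑ ρ, d ρ • F ρ ≠ 0) :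
    ∃ ρ, p ρ ∈ (∑ ρ, d ρ • F ρ).support ∧ ∀ q ∈ (∑ ρ, d ρ • F ρ).support, ω (p ρ) ≤ ω q := by
  classical
  -- the index of least pivot weight among those with a nonzero coefficient
  obtain ⟨ρs, hρs, hmin⟩ := (Finset.univ.filter fun ρ => d ρ ≠ 0).exists_min_image (fun ρ => ω (p ρ)) (by
    by_contra h
    rw [Finset.not_nonempty_iff_eq_empty, Finset.filter_eq_empty_iff] at h
    apply hf
    exact Finset.sum_eq_zero fun ρ hρ => by rw [not_not.mp (h hρ), zero_smul])
  have hds : d ρs ≠ 0 := (Finset.mem_filter.mp hρs).2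
  have hmin' : ∀ ρ, d ρ ≠ 0 → ω (p ρs) ≤ ω (p ρ) := fun ρ hd =>
    hmin ρ (Finset.mem_filter.mpr ⟨Finset.mem_univ _, hd⟩)
  -- no other `F ρ` with `d ρ ≠ 0` sees the pivot `p ρs`
  have hvan : ∀ ρ, ρ ≠ ρs → d ρ * coeff (p ρs) (F ρ) = 0 := by
    intro ρ hne
    by_cases hd : d ρ = 0
    · rw [hd, zero_mul]
    · rw [mul_eq_zero]
      right
      by_contra hc
      have hlt := (hp ρ).2 _ (mem_support_iff.mpr hc) fun h => hne (hinj h.symm)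
      exact absurd (hmin' ρ hd) (not_le.mpr hlt)
  refine ⟨ρs, ?_, ?_⟩
  · rw [mem_support_iff, coeff_sum, Finset.sum_eq_single_of_mem ρs (Finset.mem_univ _)]
    · rw [coeff_smul, smul_eq_mul]
      exact mul_ne_zero hds (mem_support_iff.mp (hp ρs).1)
    · intro ρ _ hne
      rw [coeff_smul, smul_eq_mul, hvan ρ hne]
  · intro q hq
    obtain ⟨ρ, -, hρ⟩ := Finset.mem_biUnion.mp (MvPolynomial.support_sum hq)
    have hqF : q ∈ (F ρ).support := MvPolynomial.support_smul hρ
    have hd : d ρ ≠ 0 := by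
      rintro h0
      simp [h0] at hρ
    rcases eq_or_ne q (p ρ) with h | h
    · rw [h]
      exact hmin' ρ hd
    · exact (hmin' ρ hd).trans ((hp ρ).2 q hqF h).le

/-- `exists_echelon` for a family indexed by a finite type: `r ≤ card ι` echelon generators supported in the
letter set `U`, spanning a space containing the family, with pairwise distinct strict `ω`-minimal pivots.
[folklore] -/
theorem exists_echelon_fintype {ι : Type*} [Fintype ι] (U : Finset (σ →₀ ℕ)) (ω : (σ →₀ ℕ) → ℤ)
    (hω : ∀ q ∈ U, ∀ q' ∈ U, ω q = ω q' → q = q') (g : ι → MvPolynomial σ K)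
    (hgU : ∀ i, (g i).support ⊆ U) :
    ∃ (r : ℕ) (F : Fin r → MvPolynomial σ K) (p : Fin r → (σ →₀ ℕ)),
      r ≤ Fintype.card ι ∧ (∀ i, g i ∈ Submodule.span K (Set.range F)) ∧ (∀ ρ, (F ρ).support ⊆ U) ∧
      (∀ ρ, p ρ ∈ (F ρ).support ∧ ∀ q ∈ (F ρ).support, q ≠ p ρ → ω (p ρ) < ω q) ∧
      Function.Injective p := by
  obtain ⟨r, F, p, hr, hspan, hFU, hp, hinj⟩ :=
    exists_echelon U ω hω (Fintype.card ι) (g ∘ (Fintype.equivFin ι).symm) fun i => hgU _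
  refine ⟨r, F, p, hr, fun i => ?_, hFU, hp, hinj⟩
  have h := hspan (Fintype.equivFin ι i)
  rwa [Function.comp_apply, Equiv.symm_apply_apply] at h

end Axes

/-! ## Two variables: rows of a sum of separated products -/

/-- COEFFICIENTS FACTOR.  For `P` supported on the `x`-axis and `Q` on the `y`-axis,
`[x^a y^b] (P·Q) = [x^a] P · [y^b] Q`. [folklore] -/
theorem coeff_mul_of_axes (P Q : MvPolynomial (Fin 2) K) (hP : ∀ q ∈ P.support, q 1 = 0)
    (hQ : ∀ q ∈ Q.support, q 0 = 0) (q : Fin 2 →₀ ℕ) :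
    coeff q (P * Q) = coeff (Finsupp.single 0 (q 0)) P * coeff (Finsupp.single 1 (q 1)) Q := by
  classical
  have hq : (Finsupp.single 0 (q 0) + Finsupp.single 1 (q 1) : Fin 2 →₀ ℕ) = q := by
    ext i
    fin_cases i <;> simp
  have key : ∀ x ∈ antidiagonal q, x ≠ (Finsupp.single 0 (q 0), Finsupp.single 1 (q 1)) →
      coeff x.1 P * coeff x.2 Q = 0 := by
    rintro ⟨a, b⟩ hab hne
    simp only [mem_antidiagonal] at hab
    by_contra hprod
    obtain ⟨ha, hb⟩ := mul_ne_zero_iff.mp hprod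
    have ha1 : a 1 = 0 := hP a (mem_support_iff.mpr ha)
    have hb0 : b 0 = 0 := hQ b (mem_support_iff.mpr hb)
    apply hne
    simp only [Prod.mk.injEq]
    constructor
    · ext i
      fin_cases i
      · simp [← hab, hb0]
      · simp [ha1]
    · ext i
      fin_cases i
      · simp [hb0]
      · simp [← hab, ha1]
  rw [coeff_mul]
  exact Finset.sum_eq_single_of_mem (Finsupp.single 0 (q 0), Finsupp.single 1 (q 1))
    (mem_antidiagonal.mpr hq) key

/-- ROWS.  For `x`-axis `R k` and `y`-axis `Γ k`, the coefficient of `x^a y^b` in `Σ_k R k · Γ k` is the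
coefficient of `x^a` in the row polynomial `Σ_k [y^b]Γ k • R k`. [folklore] -/
theorem coeff_sum_mul_of_axes {ι : Type*} [Fintype ι] (R Γ : ι → MvPolynomial (Fin 2) K)
    (hR : ∀ k, ∀ q ∈ (R k).support, q 1 = 0) (hΓ : ∀ k, ∀ q ∈ (Γ k).support, q 0 = 0)
    (q : Fin 2 →₀ ℕ) :
    coeff q (∑ k, R k * Γ k) =
      coeff (Finsupp.single 0 (q 0)) (∑ k, coeff (Finsupp.single 1 (q 1)) (Γ k) • R k) := by
  simp only [coeff_sum, coeff_smul, smul_eq_mul]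
  exact Finset.sum_congr rfl fun k _ => by rw [coeff_mul_of_axes (R k) (Γ k) (hR k) (hΓ k), mul_comm]

/-! ## Counting vertices through the rows -/

/-- ABSTRACT COUNT.  If every row of `D` (`Row m`, with `[x^a y^m] D = [x^a] Row m`) lies in the span of a
family of `card ι` polynomials supported on the `x`-axis, then `D` has at most `card ι` south-west vertices:
the abscissa of a vertex is the least abscissa of its (nonzero) row, hence one of the `r ≤ card ι` pivot
abscissae of an echelon family of that span, and vertices are determined by their abscissa. [folklore] -/
theorem ncard_vertices_le {ι : Type*} [Fintype ι] (D : MvPolynomial (Fin 2) K)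
    (G : ι → MvPolynomial (Fin 2) K) (hG : ∀ k, ∀ q ∈ (G k).support, q 1 = 0)
    (Row : ℕ → MvPolynomial (Fin 2) K) (hRow : ∀ m, Row m ∈ Submodule.span K (Set.range G))
    (hcoeff : ∀ q, coeff q D = coeff (Finsupp.single 0 (q 0)) (Row (q 1))) :
    {e : Fin 2 →₀ ℕ | ∃ w : Fin 2 → ℤ, 0 < w 0 ∧ 0 < w 1 ∧ e ∈ D.support ∧
        ∀ e' ∈ D.support, e' ≠ e →
          w 0 * (e 0 : ℤ) + w 1 * (e 1 : ℤ) < w 0 * (e' 0 : ℤ) + w 1 * (e' 1 : ℤ)}.ncard ≤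
      Fintype.card ι := by
  classical
  set V := {e : Fin 2 →₀ ℕ | ∃ w : Fin 2 → ℤ, 0 < w 0 ∧ 0 < w 1 ∧ e ∈ D.support ∧
        ∀ e' ∈ D.support, e' ≠ e →
          w 0 * (e 0 : ℤ) + w 1 * (e 1 : ℤ) < w 0 * (e' 0 : ℤ) + w 1 * (e' 1 : ℤ)} with hV
  -- the letter set lies on the `x`-axis, where the abscissa is an injective weight
  set U : Finset (Fin 2 →₀ ℕ) := Finset.univ.biUnion fun k => (G k).support with hU
  have hU1 : ∀ q ∈ U, q 1 = 0 := fun q hq => by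
    obtain ⟨k, -, hk⟩ := Finset.mem_biUnion.mp hq
    exact hG k q hk
  have hω : ∀ q ∈ U, ∀ q' ∈ U, ((q 0 : ℕ) : ℤ) = ((q' 0 : ℕ) : ℤ) → q = q' := by
    intro q hq q' hq' h
    have h0 : q 0 = q' 0 := by exact_mod_cast h
    ext i
    fin_cases i
    · simpa using h0
    · simp [hU1 q hq, hU1 q' hq']
  obtain ⟨r, F, p, hr, hspan, hFU, hp, hinj⟩ := exists_echelon_fintype U (fun q : Fin 2 →₀ ℕ => (q 0 : ℤ))
    hω G fun k => Finset.subset_biUnion_of_mem (fun k => (G k).support) (Finset.mem_univ k)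
  have hle : Submodule.span K (Set.range G) ≤ Submodule.span K (Set.range F) :=
    Submodule.span_le.mpr (by
      rintro _ ⟨k, rfl⟩
      exact hspan k)
  -- every vertex abscissa is a pivot abscissa
  have key : ∀ e ∈ V, e 0 ∈ (↑(Finset.univ.image fun ρ => p ρ 0) : Set ℕ) := by
    rintro e ⟨w, hw0, hw1, heD, hmin⟩
    have hf0 : coeff (Finsupp.single 0 (e 0)) (Row (e 1)) ≠ 0 := by
      rw [← hcoeff]
      exact mem_support_iff.mp heD
    obtain ⟨d, hd⟩ := (Submodule.mem_span_range_iff_exists_fun K).mp (hle (hRow (e 1)))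
    have hfne : ∑ ρ, d ρ • F ρ ≠ 0 := by
      rw [hd]
      intro h
      rw [h, coeff_zero] at hf0
      exact hf0 rfl
    obtain ⟨ρs, hps, hpmin⟩ := exists_min_pivot F p (fun q : Fin 2 →₀ ℕ => (q 0 : ℤ)) hp hinj d hfne
    rw [hd] at hps hpmin
    have hp1 : p ρs 1 = 0 := hU1 _ (hFU ρs (hp ρs).1)
    have hpe : Finsupp.single 0 (p ρs 0) = p ρs := by
      ext i
      fin_cases i
      · simp
      · simp [hp1]
    obtain ⟨h0, h1⟩ := leader_apply (p ρs 0) (e 1)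
    -- the point `(p ρs 0, e 1)` of the support of `D`, weakly left of `e` on its row
    have hq'D : (Finsupp.single 0 (p ρs 0) + Finsupp.single 1 (e 1) : Fin 2 →₀ ℕ) ∈ D.support := by
      rw [mem_support_iff, hcoeff, h0, h1, hpe]
      exact mem_support_iff.mp hps
    have hle0 : ((p ρs 0 : ℕ) : ℤ) ≤ e 0 := by simpa using hpmin _ (mem_support_iff.mpr hf0)
    have heq : (Finsupp.single 0 (p ρs 0) + Finsupp.single 1 (e 1) : Fin 2 →₀ ℕ) = e := by
      by_contra hne
      have hlt := hmin _ hq'D hne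
      rw [h0, h1] at hlt
      nlinarith
    refine Finset.mem_coe.mpr (Finset.mem_image.mpr ⟨ρs, Finset.mem_univ _, ?_⟩)
    have h0' := congrArg (fun f : Fin 2 →₀ ℕ => f 0) heq
    simp only [h0] at h0'
    exact h0'
  -- a vertex is determined by its abscissa
  have hinjOn : Set.InjOn (fun e : Fin 2 →₀ ℕ => e 0) V := by
    rintro e ⟨w, hw0, hw1, heD, hmin⟩ e' ⟨w', hw0', hw1', heD', hmin'⟩ h0
    change e 0 = e' 0 at h0
    by_contra hne
    have h1 : e 1 ≠ e' 1 := by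
      intro h1
      apply hne
      ext i
      fin_cases i
      · simpa using h0
      · simpa using h1
    have h0' : ((e 0 : ℕ) : ℤ) = e' 0 := by exact_mod_cast h0
    rcases lt_or_gt_of_ne h1 with h | h
    · have hlt := hmin' e heD hne
      have h' : ((e 1 : ℕ) : ℤ) < e' 1 := by exact_mod_cast h
      nlinarith
    · have hlt := hmin e' heD' (Ne.symm hne)
      have h' : ((e' 1 : ℕ) : ℤ) < e 1 := by exact_mod_cast h
      nlinarith
  calc V.ncard ≤ (↑(Finset.univ.image fun ρ => p ρ 0) : Set ℕ).ncard :=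
        Set.ncard_le_ncard_of_injOn (fun e : Fin 2 →₀ ℕ => e 0) key hinjOn (Finset.finite_toSet _)
    _ = (Finset.univ.image fun ρ => p ρ 0).card := Set.ncard_coe_finset _
    _ ≤ (Finset.univ : Finset (Fin r)).card := Finset.card_image_le
    _ = r := by rw [Finset.card_univ, Fintype.card_fin]
    _ ≤ Fintype.card ι := hr

/-- TWO SUMS OF SEPARATED PRODUCTS.  For `x`-axis `R k, R' k` and `y`-axis `Γ k, Γ' k`, the difference
`Σ_k R k·Γ k − Σ_k R' k·Γ' k` has at most `2·card ι` south-west vertices (its rows lie in the span of the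
`R k, R' k`). [folklore] -/
theorem ncard_vertices_sub_le {ι : Type*} [Fintype ι] (R Γ R' Γ' : ι → MvPolynomial (Fin 2) K)
    (hR : ∀ k, ∀ q ∈ (R k).support, q 1 = 0) (hΓ : ∀ k, ∀ q ∈ (Γ k).support, q 0 = 0)
    (hR' : ∀ k, ∀ q ∈ (R' k).support, q 1 = 0) (hΓ' : ∀ k, ∀ q ∈ (Γ' k).support, q 0 = 0) :
    {e : Fin 2 →₀ ℕ | ∃ w : Fin 2 → ℤ, 0 < w 0 ∧ 0 < w 1 ∧
        e ∈ ((∑ k, R k * Γ k) - ∑ k, R' k * Γ' k).support ∧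
        ∀ e' ∈ ((∑ k, R k * Γ k) - ∑ k, R' k * Γ' k).support, e' ≠ e →
          w 0 * (e 0 : ℤ) + w 1 * (e 1 : ℤ) < w 0 * (e' 0 : ℤ) + w 1 * (e' 1 : ℤ)}.ncard ≤
      Fintype.card ι + Fintype.card ι := by
  classical
  set D : MvPolynomial (Fin 2) K := (∑ k, R k * Γ k) - ∑ k, R' k * Γ' k with hD
  have hG : ∀ k, ∀ q ∈ (Sum.elim R R' k).support, q 1 = 0 := by
    rintro (k | k)
    exacts [hR k, hR' k]
  have hRow : ∀ m : ℕ, ((∑ k, coeff (Finsupp.single 1 m) (Γ k) • R k) -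
      ∑ k, coeff (Finsupp.single 1 m) (Γ' k) • R' k) ∈ Submodule.span K (Set.range (Sum.elim R R')) :=
    fun m => sub_mem
      (sum_mem fun k _ => Submodule.smul_mem _ _ (Submodule.subset_span ⟨Sum.inl k, rfl⟩))
      (sum_mem fun k _ => Submodule.smul_mem _ _ (Submodule.subset_span ⟨Sum.inr k, rfl⟩))
  have hcoeff : ∀ q : Fin 2 →₀ ℕ, coeff q D = coeff (Finsupp.single 0 (q 0))
      ((∑ k, coeff (Finsupp.single 1 (q 1)) (Γ k) • R k) -
        ∑ k, coeff (Finsupp.single 1 (q 1)) (Γ' k) • R' k) := fun q => by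
    rw [hD, coeff_sub, coeff_sub, coeff_sum_mul_of_axes R Γ hR hΓ, coeff_sum_mul_of_axes R' Γ' hR' hΓ']
  have h := ncard_vertices_le D (Sum.elim R R') hG _ hRow hcoeff
  rwa [Fintype.card_sum] at h

/-! ## The registered stub -/

/-- STUB `stub_engineSeparated` (registered vocabulary).  Separated factors `u_i = A_i(x) + B_i(x)·g_i(y)`,
`v_i = A'_i(x) + B'_i(x)·g'_i(y)` (`A_i, B_i, A'_i, B'_i` supported on the `x`-axis, `g_i, g'_i` on the
`y`-axis): `∏ u_i − ∏ v_i` has at most `2^(n+1)` south-west vertices, uniformly in the number of monomials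
and in the degrees. [folklore] -/
theorem stub_engineSeparated : ∀ (n : ℕ) (A B A' B' g g' : Fin n → MvPolynomial (Fin 2) ℂ),
    (∀ i, ∀ q ∈ (A i).support, q 1 = 0) → (∀ i, ∀ q ∈ (B i).support, q 1 = 0) →
    (∀ i, ∀ q ∈ (A' i).support, q 1 = 0) → (∀ i, ∀ q ∈ (B' i).support, q 1 = 0) →
    (∀ i, ∀ q ∈ (g i).support, q 0 = 0) → (∀ i, ∀ q ∈ (g' i).support, q 0 = 0) →
    {e : Fin 2 →₀ ℕ | ∃ w : Fin 2 → ℤ, 0 < w 0 ∧ 0 < w 1 ∧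
        e ∈ ((∏ i, (A i + B i * g i)) - ∏ i, (A' i + B' i * g' i)).support ∧
        ∀ e' ∈ ((∏ i, (A i + B i * g i)) - ∏ i, (A' i + B' i * g' i)).support, e' ≠ e →
          w 0 * (e 0 : ℤ) + w 1 * (e 1 : ℤ) < w 0 * (e' 0 : ℤ) + w 1 * (e' 1 : ℤ)}.ncard ≤ 2 ^ (n + 1) := by
  intro n A B A' B' g g' hA hB hA' hB' hg hg'
  classical
  -- expand the products over the subsets `t` of factors contributing `A_i`
  have expand : ∀ A₁ B₁ g₁ : Fin n → MvPolynomial (Fin 2) ℂ, ∏ i, (A₁ i + B₁ i * g₁ i) =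
      ∑ t : Finset (Fin n), ((∏ i ∈ t, A₁ i) * ∏ i ∈ Finset.univ \ t, B₁ i) *
        ∏ i ∈ Finset.univ \ t, g₁ i := by
    intro A₁ B₁ g₁
    rw [Finset.prod_add, Finset.powerset_univ]
    refine Finset.sum_congr rfl fun t _ => ?_
    rw [Finset.prod_mul_distrib, mul_assoc]
  have hR : ∀ A₁ B₁ : Fin n → MvPolynomial (Fin 2) ℂ, (∀ i, ∀ q ∈ (A₁ i).support, q 1 = 0) →
      (∀ i, ∀ q ∈ (B₁ i).support, q 1 = 0) → ∀ t : Finset (Fin n),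
      ∀ q ∈ ((∏ i ∈ t, A₁ i) * ∏ i ∈ Finset.univ \ t, B₁ i).support, q 1 = 0 :=
    fun A₁ B₁ h₁ h₂ t => mul_support_apply_eq_zero 1 _ _
      (prod_support_apply_eq_zero 1 t A₁ fun i _ => h₁ i)
      (prod_support_apply_eq_zero 1 _ B₁ fun i _ => h₂ i)
  rw [expand A B g, expand A' B' g']
  refine (ncard_vertices_sub_le
    (fun t : Finset (Fin n) => (∏ i ∈ t, A i) * ∏ i ∈ Finset.univ \ t, B i)
    (fun t : Finset (Fin n) => ∏ i ∈ Finset.univ \ t, g i)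
    (fun t : Finset (Fin n) => (∏ i ∈ t, A' i) * ∏ i ∈ Finset.univ \ t, B' i)
    (fun t : Finset (Fin n) => ∏ i ∈ Finset.univ \ t, g' i)
    (hR A B hA hB) (fun t => prod_support_apply_eq_zero 0 _ g fun i _ => hg i)
    (hR A' B' hA' hB') (fun t => prod_support_apply_eq_zero 0 _ g' fun i _ => hg' i)).trans ?_
  rw [Fintype.card_finset, Fintype.card_fin, pow_succ]
  omega

end Summit.ValiantsHypothesis.ValiantsHypothesis.Theorems.TwoProducts.Separated
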